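import Literature.Probability.Percolation.GladkovThreeClusterDichotomyProofs
import HarnessLib

/-!
# `NoHeavyLowerTail` (stmt-CriticalPhenomena-4575) — three-point lower bound `3PT-LB = SHK3⁺` by four switchings, I:
# clusters inside spliced configurations (the "sealed-island" facts F1–F4)

Support file (prover prim-cert-2; `--supports stmt-CriticalPhenomena-4575`).  No named facts, no sorries, no definitions.

This is the first of the files formalising the four-switching proof of
`F = (q + u_a + u_b + u_c + 2t)(qt − u_au_b − u_au_c − u_bu_c) − u_au_bu_c ≥ 0` (prove-2's `3PT-LB`, = `SHK3⁺`,
= Sahi's `C₃` on the three pairwise separations of three vertices) for Bernoulli bond percolation with arbitrary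
edge weights on every finite graph (prim-lit-2, `PROOF-3PTLB.md`, 2026-08-19): four three-copy switchings that
explore the clusters `A = K_a(X)`, `B = K_b(X)` of ONE copy `X` and hand their edge regions `touch A`, `touch B`
to the other two copies, an integer certificate of potentials, and a pointwise lemma.

Vocabulary (all from the tree): configurations `K : Finset (Sym2 V)` of open pairs, `cl K x` the open cluster of
`x` [GladkovZimin2024 §4], `touch W` the pairs meeting `W`, `splice F K₁ K₂` = (`K₁` on `F`, `K₂` off `F`)
[Gladkov2024 Def. 2.3].  Here: the four elementary facts about clusters in spliced configurations used by the
pointwise lemma (PROOF-3PTLB.md, F1–F4), for a cluster `W = cl X v`: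
* `cl_splice_touch` (F1): in `X on touch W, ω elsewhere` the cluster of `v` is still `W`;
* `mem_cl_splice_touch_iff_of_not_mem` (F2): for `u ∉ W`, connection from `u` there is connection by `ω`-open
  pairs not meeting `W` (`cl (ω \ touch W) u`);
* `cl_subset_cl_splice_touch_of_not_mem` (F3): for `u ∉ W`, the `X`-cluster of `u` survives in `ω on touch W, X elsewhere`;
* `cl_subset_cl_splice_sdiff` / `cl_sdiff_touch_subset_cl_splice` (F4): for disjoint clusters `A = cl X a`,
  `B = cl X b`, in `X on touch B \ touch A, ω elsewhere` the set `B` is still connected, and an `ω`-path avoiding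
  `B` stays open.
-/

noncomputable section

namespace Summit.CriticalPhenomena.PercolationContinuityZ3.Theorems

namespace ThreePointLB

open Finset Literature.Probability.Percolation Literature.Probability.Percolation.DecisionTree
open Literature.Probability.Percolation.Gladkov
open scoped Classical

variable {V : Type*} [Fintype V] [DecidableEq V]

/-! ### Small cluster calculus -/

omit [DecidableEq V] in
/-- Transitivity of `cl`-membership: `v ∈ cl K u`, `w ∈ cl K v` give `w ∈ cl K u`. [folklore] -/
theorem mem_cl_trans {K : Finset (Sym2 V)} {u v w : V} (huv : v ∈ cl K u) (hvw : w ∈ cl K v) :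
    w ∈ cl K u :=
  mem_cl.2 ((mem_cl.1 huv).trans (mem_cl.1 hvw))

omit [DecidableEq V] in
/-- Two vertices of one cluster have the same cluster. [folklore] -/
theorem cl_eq_cl_of_mem {K : Finset (Sym2 V)} {v w : V} (hw : w ∈ cl K v) : cl K w = cl K v := by
  ext u
  exact ⟨fun hu => mem_cl_trans hw hu, fun hu => mem_cl_trans (mem_cl_comm.1 hw) hu⟩

omit [DecidableEq V] in
/-- `cl` is monotone in the configuration. [folklore] -/
theorem cl_mono {K L : Finset (Sym2 V)} (h : K ⊆ L) (u : V) : cl K u ⊆ cl L u := fun _ hv =>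
  mem_cl.2 (reachable_mono h (mem_cl.1 hv))

omit [Fintype V] in
/-- Off `G ⊇ F`, the configuration `splice F X ω` contains `ω`: `ω \ G ⊆ splice F X ω`. [folklore] -/
theorem sdiff_subset_splice {F G X ω : Finset (Sym2 V)} (hFG : F ⊆ G) : ω \ G ⊆ splice F X ω := by
  intro e he
  rw [Finset.mem_sdiff] at he
  exact (mem_splice_of_not_mem fun h => he.2 (hFG h)).2 he.1

/-- A vertex joined to `u ∉ W` by `ω`-open pairs not meeting `W` is not in `W`. [folklore] -/
theorem not_mem_of_mem_cl_sdiff_touch {ω : Finset (Sym2 V)} {W : Finset V} {u u' : V} (hu : u ∉ W)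
    (hu' : u' ∈ cl (ω \ touch W) u) : u' ∉ W := by
  obtain ⟨w⟩ := mem_cl.1 hu'
  have hC : ∀ y y', y ∈ Finset.univ.filter (fun y => y ∉ W) →
      (openGraph (↑(ω \ touch W) : Set (Sym2 V))).Adj y y' → y' ∈ Finset.univ.filter (fun y => y ∉ W) := by
    intro y y' _ hyy'
    rw [adj_iff, Finset.mem_sdiff, mk_mem_touch, not_or] at hyy'
    exact Finset.mem_filter.2 ⟨Finset.mem_univ _, hyy'.1.2.2⟩
  exact (Finset.mem_filter.1 (mem_of_walk hC w (Finset.mem_filter.2 ⟨Finset.mem_univ _, hu⟩))).2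

/-! ### F1: a cluster sealed by its own boundary -/

/-- **(F1)** In `X on touch (cl X v), ω elsewhere` the open cluster of `v` is `cl X v`: the pairs inside the
cluster carry `X`, and every pair leaving it meets it, carries `X`, and is `X`-closed. [folklore] -/
theorem cl_splice_touch (X ω : Finset (Sym2 V)) (v : V) :
    cl (splice (touch (cl X v)) X ω) v = cl X v :=
  cl_eq_of_agree fun _ he => (mem_splice_of_mem he).symm

/-- (F1) for any vertex of the cluster: its cluster in `X on touch (cl X v), ω elsewhere` is `cl X v`. [folklore] -/
theorem mem_cl_splice_touch_iff_of_mem {X ω : Finset (Sym2 V)} {v w : V} (hw : w ∈ cl X v) (u : V) :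
    u ∈ cl (splice (touch (cl X v)) X ω) w ↔ u ∈ cl X v := by
  have hw' : w ∈ cl (splice (touch (cl X v)) X ω) v := by rw [cl_splice_touch]; exact hw
  rw [cl_eq_cl_of_mem hw', cl_splice_touch]

/-! ### F2: outside the sealed cluster one moves by `ω`-pairs avoiding it -/

/-- A pair open in `X on touch W, ω elsewhere` (`W = cl X v`) with one endpoint off `W` has both endpoints
off `W`. [folklore] -/
theorem not_mem_of_adj_splice_touch {X ω : Finset (Sym2 V)} {v y y' : V} (hy : y ∉ cl X v)
    (h : (openGraph (↑(splice (touch (cl X v)) X ω) : Set (Sym2 V))).Adj y y') : y' ∉ cl X v := by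
  intro hy'
  rw [adj_iff] at h
  have heX : s(y, y') ∈ X := (mem_splice_of_mem (mk_mem_touch.2 (Or.inr hy'))).1 h.1
  exact hy (mem_cl_of_adj hy' (adj_iff.2 ⟨by rw [Sym2.eq_swap]; exact heX, h.2.symm⟩))

/-- **(F2)** For `u ∉ W = cl X v`: in `X on touch W, ω elsewhere`, `u` is joined to `u'` iff it is joined to
`u'` by `ω`-open pairs not meeting `W` (an open path from `u` never enters the sealed cluster). [folklore] -/
theorem mem_cl_splice_touch_iff_of_not_mem {X ω : Finset (Sym2 V)} {v u : V} (hu : u ∉ cl X v) (u' : V) :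
    u' ∈ cl (splice (touch (cl X v)) X ω) u ↔ u' ∈ cl (ω \ touch (cl X v)) u := by
  constructor
  · intro h
    obtain ⟨w⟩ := mem_cl.1 h
    refine mem_cl.2 (reachable_of_walk (C := Finset.univ.filter fun y => y ∉ cl X v) ?_ ?_ w
      (Finset.mem_filter.2 ⟨Finset.mem_univ _, hu⟩))
    · intro y y' hy hyy'
      exact Finset.mem_filter.2 ⟨Finset.mem_univ _,
        not_mem_of_adj_splice_touch (Finset.mem_filter.1 hy).2 hyy'⟩
    · intro y y' hy hyy'
      have hyW := (Finset.mem_filter.1 hy).2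
      have hy'W := not_mem_of_adj_splice_touch hyW hyy'
      rw [adj_iff] at hyy' ⊢
      have he : s(y, y') ∉ touch (cl X v) := by rw [mk_mem_touch, not_or]; exact ⟨hyW, hy'W⟩
      exact ⟨Finset.mem_sdiff.2 ⟨(mem_splice_of_not_mem he).1 hyy'.1, he⟩, hyy'.2⟩
  · intro h
    exact cl_mono (sdiff_subset_splice subset_rfl) u h

/-! ### F3: a cluster not meeting `W` survives when `touch W` is overwritten -/

/-- **(F3)** For `u ∉ W = cl X v`: the `X`-cluster of `u` is contained in the cluster of `u` in
`ω on touch W, X elsewhere` (an `X`-open pair of `cl X u` has no endpoint in `W`). [folklore] -/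
theorem cl_subset_cl_splice_touch_of_not_mem {X ω : Finset (Sym2 V)} {v u : V} (hu : u ∉ cl X v) :
    cl X u ⊆ cl (splice (touch (cl X v)) ω X) u := by
  intro u' hu'
  obtain ⟨w⟩ := mem_cl.1 hu'
  refine mem_cl.2 (reachable_of_walk (C := cl X u) (fun y y' hy hyy' => mem_cl_of_adj hy hyy') ?_ w
    (mem_cl_self X u))
  intro y y' hy hyy'
  have hy' : y' ∈ cl X u := mem_cl_of_adj hy hyy'
  have hyW : y ∉ cl X v := fun h => hu (mem_cl_trans h (mem_cl_comm.1 hy))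
  have hy'W : y' ∉ cl X v := fun h => hu (mem_cl_trans h (mem_cl_comm.1 hy'))
  rw [adj_iff] at hyy' ⊢
  have he : s(y, y') ∉ touch (cl X v) := by rw [mk_mem_touch, not_or]; exact ⟨hyW, hy'W⟩
  exact ⟨(mem_splice_of_not_mem he).2 hyy'.1, hyy'.2⟩

/-! ### F4: two disjoint clusters, the second sealed outside the first -/

/-- **(F4, i)** If `b ∉ cl X a`, the cluster `B = cl X b` is connected in `X on touch B \ touch A, ω elsewhere`
(`A = cl X a`): its internal `X`-open pairs meet `B` and not `A`. [folklore] -/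
theorem cl_subset_cl_splice_sdiff {X : Finset (Sym2 V)} {a b : V} (hab : b ∉ cl X a) (ω : Finset (Sym2 V)) :
    cl X b ⊆ cl (splice (touch (cl X b) \ touch (cl X a)) X ω) b := by
  intro u hu
  obtain ⟨w⟩ := mem_cl.1 hu
  refine mem_cl.2 (reachable_of_walk (C := cl X b) (fun y y' hy hyy' => mem_cl_of_adj hy hyy') ?_ w
    (mem_cl_self X b))
  intro y y' hy hyy'
  have hy' : y' ∈ cl X b := mem_cl_of_adj hy hyy'
  have hyA : y ∉ cl X a := fun h => hab (mem_cl_trans h (mem_cl_comm.1 hy))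
  have hy'A : y' ∉ cl X a := fun h => hab (mem_cl_trans h (mem_cl_comm.1 hy'))
  rw [adj_iff] at hyy' ⊢
  have he : s(y, y') ∈ touch (cl X b) \ touch (cl X a) :=
    Finset.mem_sdiff.2 ⟨mk_mem_touch.2 (Or.inl hy), by rw [mk_mem_touch, not_or]; exact ⟨hyA, hy'A⟩⟩
  exact ⟨(mem_splice_of_mem he).2 hyy'.1, hyy'.2⟩

/-- **(F4, ii)** An `ω`-path avoiding the vertex set `W` stays open in `X on F, ω elsewhere` for every
`F ⊆ touch W` (it uses no pair of `touch W`). [folklore] -/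
theorem cl_sdiff_touch_subset_cl_splice {F X ω : Finset (Sym2 V)} {W : Finset V} (hF : F ⊆ touch W) (u : V) :
    cl (ω \ touch W) u ⊆ cl (splice F X ω) u :=
  cl_mono (sdiff_subset_splice hF) u

end ThreePointLB

end Summit.CriticalPhenomena.PercolationContinuityZ3.Theorems

end
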